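import Literature.AlgebraicGeometry.Motives.SmoothMorphismSubmersion
import Mathlib.RingTheory.Smooth.Locus
import HarnessLib

/-!
# A morphism together with functions cutting out a smooth stratum is a submersion on complex points

Topic `Literature/AlgebraicGeometry/Motives`. Companion of `SmoothMorphismSubmersion.lean`
(`surjective_fderiv_chart_map`: a smooth morphism of smooth `ℂ`-schemes is a submersion on complex
points, read in algebraic charts). Here the RELATIVE version used for families with a normal
crossings boundary (adapted coordinates, Voisin I §9.1 / Ehresmann with boundary): let `g : X ⟶ Y`
be a morphism of `ℂ`-schemes, `ι : Z ⟶ X` an affine morphism (a closed subscheme, "the stratum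
through `P`"), `P' ∈ Z(ℂ)` over `P ∈ X(ℂ)`, and `w₁, …, w_r ∈ Γ(X, U)` regular functions on an
affine open `U ∋ P` which VANISH ON `Z` (`ι^* wᵢ = 0`) and are linearly independent in
`𝔪_P/𝔪_P²` (`𝔪_P = ker (evaluation at P) ⊂ Γ(X, U)`). If the composite `Z → Y` is smooth at `P'`
(Mathlib `Scheme.Hom.smoothLocus`) and `X(ℂ)` has the algebraic embedding dimension at `P` (local
coordinates `t₁, …, tₙ`, `exists_localCoordinates_le`), then in algebraic charts `e_X` at `P`,
`e_Y` at `Q = g(P)` the map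

  `ξ ↦ ( d(e_Y ∘ g(ℂ) ∘ e_X⁻¹)(ξ), (d(wᵢ ∘ e_X⁻¹)(ξ))ᵢ ) : ℂⁿ → ℂᵐ × ℂʳ`

is ONTO (`surjective_fderiv_chart_map_prod`), i.e. `(g, w) : X → Y × 𝔸ʳ` is a submersion at `P`
on complex points. Proof (tangent vectors as point derivations, as in the absolute case): a linear
relation `∑ aⱼ d(g^*uⱼ) + ∑ bᵢ dwᵢ = 0` between the differentials is tested against the tangent
vectors `ξ` obtained by extending the point derivations `s ↦ d(s ∘ e_Y⁻¹)(v)` of `Γ(Y, V₁)` along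
the formally smooth `Γ(Y, V₁) → 𝒪_{Z,P'}` (Stacks 00TI, the tree's
`Literature.RingTheory.Smooth.exists_pointDerivation_comp_eq`) and composing with
`Γ(X, U) → Γ(Z, ι⁻¹U) → 𝒪_{Z,P'}` — these kill the `wᵢ` and give `∑ aⱼ vⱼ = 0` for all `v`, so
`a = 0`; then `d(∑ bᵢ wᵢ) = 0` forces `∑ bᵢ wᵢ ∈ 𝔪_P²` (`GAGADimension.mem_sq_of_fderiv_chart_eq_zero`,
Serre GAGA §2 n°6 Cor. 2), so `b = 0`. Linear independence of the `m + r` differentials is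
surjectivity of the displayed map (`surjective_pi_of_linearIndependent`).

Everything is proved; no named facts.

## References

* A. Grothendieck, M. Raynaud, *SGA 1*, Exp. XII, Prop. 3.1 (iv). [SGA1]
* J.-P. Serre, *Géométrie algébrique et géométrie analytique*, Ann. Inst. Fourier 6 (1956), §2 n°5
  Prop. 2, n°6 Cor. 2. [SerreGAGA1956]
* The Stacks Project, Tags 00TI, 00TB. [StacksProject]
* C. Voisin, *Hodge Theory and Complex Algebraic Geometry I* (2002), §9.1.1 (Ehresmann). [VoisinHodgeI2002]
-/

noncomputable section

open CategoryTheory AlgebraicGeometry Filter Topology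
open scoped ContDiff
open Literature.AlgebraicGeometry.Motives.AlgPoints (evalOrZero evalOrZero_of_mem evalOrZero_of_not_mem)
open Literature.AlgebraicGeometry.HodgeTheory.GAGADimension

namespace Literature.AlgebraicGeometry.Motives

/-! ### Linear algebra: independent linear forms give a surjection -/

/-- **Independent linear forms are jointly onto**: if `ℓ₁, …, ℓ_c` are linearly independent
linear forms on `V`, then `ξ ↦ (ℓⱼ ξ)ⱼ : V → ℂᶜ` is surjective (a non-zero form vanishing on the
range would be a vanishing non-trivial combination of the `ℓⱼ`). [folklore] -/
theorem surjective_pi_of_linearIndependent {V : Type*} [AddCommGroup V] [Module ℂ V] {c : ℕ}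
    (ℓ : Fin c → V →ₗ[ℂ] ℂ) (h : LinearIndependent ℂ ℓ) :
    Function.Surjective (LinearMap.pi ℓ) := by
  classical
  by_contra hs
  have hlt : LinearMap.range (LinearMap.pi ℓ) < ⊤ :=
    lt_top_iff_ne_top.2 fun htop => hs (LinearMap.range_eq_top.1 htop)
  obtain ⟨μ, hμ0, hμ⟩ := Submodule.exists_le_ker_of_lt_top _ hlt
  -- `∑ⱼ μ(eⱼ) ℓⱼ = μ ∘ (ℓⱼ)ⱼ = 0`
  have hrel : ∑ j, μ (Pi.single j 1) • ℓ j = 0 := by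
    ext v
    have hv : LinearMap.pi ℓ v ∈ LinearMap.ker μ := hμ (LinearMap.mem_range_self _ v)
    rw [LinearMap.mem_ker, dual_apply_eq_sum] at hv
    simpa [mul_comm] using hv
  have hc : ∀ j, μ (Pi.single j 1) = 0 := Fintype.linearIndependent_iff.1 h _ hrel
  apply hμ0
  refine LinearMap.ext fun w => ?_
  rw [LinearMap.zero_apply, dual_apply_eq_sum]
  simp [hc]

/-! ### Membership in a basic open and the prime of a point -/

/-- A point of an affine open `U` lies in the basic open `D(s)`, `s ∈ Γ(U)`, iff `s` is not in
the prime ideal of the point (a private copy of the tree's lemma of the same name, to keep the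
imports light). [folklore] -/
private theorem mem_basicOpen_iff_notMem_primeIdealOf_aux {X : Scheme} {U : X.Opens} (hU : IsAffineOpen U)
    {x : X} (hx : x ∈ U) (s : Γ(X, U)) :
    x ∈ X.basicOpen s ↔ s ∉ (hU.primeIdealOf ⟨x, hx⟩).asIdeal := by
  rw [← PrimeSpectrum.mem_basicOpen, ← hU.fromSpec_preimage_basicOpen s]
  change _ ↔ hU.fromSpec (hU.primeIdealOf ⟨x, hx⟩) ∈ X.basicOpen s
  rw [hU.fromSpec_primeIdealOf ⟨x, hx⟩]

/-! ### The relative submersion theorem -/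

variable {X Y Z : SchemeOver ℂ} {n m : ℕ}

/-- **`(g, w) : X → Y × 𝔸ʳ` is a submersion at `P` on complex points when `w` cuts out a stratum
smooth over `Y` at `P`.** Notation and hypotheses: `g : X ⟶ Y`; algebraic charts `e_X` at `P`
(`hP`, `holX`, `algX`) and `e_Y` at `Q = g(P)` (`hQ`, `holY`) with coordinates `u₁, …, u_m` on
the affine open `V₁` (`hsrcY`, `hu`); an affine open `U ∋ P` with `U ⊆ g⁻¹V₁` and local
coordinates `t₁, …, tₙ` modulo `𝔪_P²` (`htspan`); an affine morphism `ι : Z ⟶ X` and a complex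
point `P'` of `Z` over `P` at which `ι ≫ g` is smooth (`hsm`); regular functions
`w₁, …, w_r ∈ Γ(X, U)` with `ι^* wᵢ = 0` (`hwZ`) which are linearly independent modulo `𝔪_P²`
(`hwind`). Conclusion: `ξ ↦ (d(e_Y ∘ g(ℂ) ∘ e_X⁻¹)(ξ), (d(wᵢ ∘ e_X⁻¹)(ξ))ᵢ)` is onto `ℂᵐ × ℂʳ`.
[cite: SGA1, Exp. XII Prop. 3.1 (iv)] [cite: StacksProject, Tag 00TI]
[cite: SerreGAGA1956, §2 n°6 Cor. 2] -/
theorem surjective_fderiv_chart_map_prod (g : X ⟶ Y)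
    (eX : OpenPartialHomeomorph (ComplexPoints X) (Fin n → ℂ)) {P : ComplexPoints X}
    (hP : P ∈ eX.source)
    (holX : ∀ (U : X.left.affineOpens) (s : Γ(X.left, ↑U)),
      ContDiffOn ℂ ω (evalOrZero ↑U s ∘ eX.symm)
        (eX.target ∩ eX.symm ⁻¹' {Q | Q.pt ∈ (↑U : X.left.Opens)}))
    (algX : ∃ (U₁ : X.left.affineOpens) (x : Fin n → Γ(X.left, ↑U₁)),
      eX.source ⊆ {Q | Q.pt ∈ (↑U₁ : X.left.Opens)} ∧
        ∀ Q ∈ eX.source, ∀ i, eX Q i = evalOrZero ↑U₁ (x i) Q)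
    (eY : OpenPartialHomeomorph (ComplexPoints Y) (Fin m → ℂ))
    (hQ : AlgPoints.map g P ∈ eY.source)
    (holY : ∀ (V : Y.left.affineOpens) (s : Γ(Y.left, ↑V)),
      ContDiffOn ℂ ω (evalOrZero ↑V s ∘ eY.symm)
        (eY.target ∩ eY.symm ⁻¹' {Q | Q.pt ∈ (↑V : Y.left.Opens)}))
    (V₁ : Y.left.affineOpens) (u : Fin m → Γ(Y.left, ↑V₁))
    (hsrcY : eY.source ⊆ {Q | Q.pt ∈ (↑V₁ : Y.left.Opens)})
    (hu : ∀ Q ∈ eY.source, ∀ j, eY Q j = evalOrZero ↑V₁ (u j) Q)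
    (U : X.left.affineOpens) (hPU : P.pt ∈ (↑U : X.left.Opens))
    (hle : (↑U : X.left.Opens) ≤ g.left ⁻¹ᵁ ↑V₁) (t : Fin n → Γ(X.left, ↑U))
    (htspan : ∀ a ∈ RingHom.ker (P.evalRingHom ↑U hPU), ∃ coef : Fin n → ℂ,
      a - ∑ i, SchemeOver.scalarRingHom X ↑U (coef i) * t i ∈
        RingHom.ker (P.evalRingHom ↑U hPU) ^ 2)
    (ι : Z ⟶ X) [IsAffineHom ι.left] [LocallyOfFinitePresentation (ι ≫ g).left]
    (P' : ComplexPoints Z) (hP' : AlgPoints.map ι P' = P)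
    (hsm : P'.pt ∈ (ι ≫ g).left.smoothLocus)
    {r : ℕ} (w : Fin r → Γ(X.left, ↑U))
    (hwZ : ∀ i, ι.left.appLE ↑U (ι.left ⁻¹ᵁ ↑U) le_rfl (w i) = 0)
    (hwind : ∀ b : Fin r → ℂ, ∑ i, SchemeOver.scalarRingHom X ↑U (b i) * w i ∈
      RingHom.ker (P.evalRingHom ↑U hPU) ^ 2 → b = 0) :
    DifferentiableAt ℂ (eY ∘ AlgPoints.map g ∘ eX.symm) (eX P) ∧
    (∀ i, DifferentiableAt ℂ (evalOrZero ↑U (w i) ∘ eX.symm) (eX P)) ∧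
    Function.Surjective fun ξ : Fin n → ℂ =>
      (fderiv ℂ (eY ∘ AlgPoints.map g ∘ eX.symm) (eX P) ξ,
        fun i => fderiv ℂ (evalOrZero ↑U (w i) ∘ eX.symm) (eX P) ξ) := by
  classical
  set Q := AlgPoints.map g P with hQdef
  have hQV₁ : Q.pt ∈ (↑V₁ : Y.left.Opens) := hsrcY hQ
  -- the pulled-back coordinates `gs j = g^* u_j ∈ Γ(X, U)` and the components of the chart map
  set gs : Fin m → Γ(X.left, ↑U) := fun j => g.left.appLE ↑V₁ ↑U hle (u j) with hgs
  set Fj : Fin m → (Fin n → ℂ) → ℂ := fun j z => eY (AlgPoints.map g (eX.symm z)) j with hFj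
  have hF : (eY ∘ AlgPoints.map g ∘ eX.symm : (Fin n → ℂ) → Fin m → ℂ) = fun z j => Fj j z := rfl
  have hnear : ∀ᶠ z in 𝓝 (eX P), AlgPoints.map g (eX.symm z) ∈ eY.source := by
    have hc : ContinuousAt (fun z => AlgPoints.map g (eX.symm z)) (eX P) :=
      (AlgPoints.continuous_map g).continuousAt.comp (eX.continuousAt_symm (eX.map_source hP))
    refine hc.preimage_mem_nhds ?_
    rw [eX.left_inv hP]
    exact eY.open_source.mem_nhds hQ
  have hFj_eq : ∀ j, Fj j =ᶠ[𝓝 (eX P)] (evalOrZero ↑U (gs j) ∘ eX.symm) := fun j => by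
    filter_upwards [hnear, eventually_chart_mem eX hP hPU] with z hz hz'
    simp only [hFj, hgs, Function.comp_apply]
    rw [hu _ hz j, evalOrZero_appLE g hle _ hz'.2]
  have hdiff : ∀ j, DifferentiableAt ℂ (Fj j) (eX P) := fun j =>
    (differentiableAt_chart eX hP holX U hPU (gs j)).congr_of_eventuallyEq (hFj_eq j)
  have hfd : ∀ j, fderiv ℂ (Fj j) (eX P) = fderiv ℂ (evalOrZero ↑U (gs j) ∘ eX.symm) (eX P) :=
    fun j => (hFj_eq j).fderiv_eq
  have hdiffG : DifferentiableAt ℂ (eY ∘ AlgPoints.map g ∘ eX.symm) (eX P) := by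
    rw [hF]; exact differentiableAt_pi.2 hdiff
  have hdiffw : ∀ i, DifferentiableAt ℂ (evalOrZero ↑U (w i) ∘ eX.symm) (eX P) := fun i =>
    differentiableAt_chart eX hP holX U hPU (w i)
  refine ⟨hdiffG, hdiffw, ?_⟩
  -- the `m + r` linear forms
  let ℓ : Fin m → (Fin n → ℂ) →L[ℂ] ℂ := fun j => fderiv ℂ (evalOrZero ↑U (gs j) ∘ eX.symm) (eX P)
  let μ : Fin r → (Fin n → ℂ) →L[ℂ] ℂ := fun i => fderiv ℂ (evalOrZero ↑U (w i) ∘ eX.symm) (eX P)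
  have hℓ : ∀ j, ℓ j = fderiv ℂ (evalOrZero ↑U (gs j) ∘ eX.symm) (eX P) := fun j => rfl
  have hμ : ∀ i, μ i = fderiv ℂ (evalOrZero ↑U (w i) ∘ eX.symm) (eX P) := fun i => rfl
  -- ### Step A: tangent vectors from point derivations of `Γ(Y, V₁)`, through the stratum
  -- the affine open `V = ι⁻¹ U` of `Z` and the rings
  have hV : IsAffineOpen (ι.left ⁻¹ᵁ ↑U) := U.2.preimage ι.left
  have hP'V : P'.pt ∈ ι.left ⁻¹ᵁ ↑U := by
    change ι.left P'.pt ∈ (↑U : X.left.Opens)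
    rw [← AlgPoints.pt_map, hP']
    exact hPU
  have hleZ : ι.left ⁻¹ᵁ ↑U ≤ (ι ≫ g).left ⁻¹ᵁ ↑V₁ := by
    rw [Over.comp_left, Scheme.Hom.comp_preimage]
    exact Scheme.Hom.preimage_mono _ hle
  let φ : Γ(Y.left, ↑V₁) →+* Γ(Z.left, ι.left ⁻¹ᵁ ↑U) :=
    ((ι ≫ g).left.appLE ↑V₁ (ι.left ⁻¹ᵁ ↑U) hleZ).hom
  let res : Γ(X.left, ↑U) →+* Γ(Z.left, ι.left ⁻¹ᵁ ↑U) :=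
    (ι.left.appLE ↑U (ι.left ⁻¹ᵁ ↑U) le_rfl).hom
  let φg : Γ(Y.left, ↑V₁) →+* Γ(X.left, ↑U) := (g.left.appLE ↑V₁ ↑U hle).hom
  have hres0 : ∀ i, res (w i) = 0 := fun i => hwZ i
  have hcomp : ∀ a, res (φg a) = φ a := fun a => by
    change (g.left.appLE ↑V₁ ↑U hle ≫ ι.left.appLE ↑U (ι.left ⁻¹ᵁ ↑U) le_rfl) a = _
    rw [Scheme.Hom.appLE_comp_appLE]
    rfl
  -- the local ring of `Z` at `P'` (a localization of `Γ(Z, ι⁻¹U)`) is formally smooth over `Γ(Y, V₁)`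
  letI algRA : Algebra Γ(Y.left, ↑V₁) Γ(Z.left, ι.left ⁻¹ᵁ ↑U) := φ.toAlgebra
  let 𝔮 : PrimeSpectrum Γ(Z.left, ι.left ⁻¹ᵁ ↑U) := hV.primeIdealOf ⟨P'.pt, hP'V⟩
  have hsmS : Algebra.FormallySmooth Γ(Y.left, ↑V₁) (Localization.AtPrime 𝔮.asIdeal) :=
    (formallySmooth_stalkMap_iff (f := (ι ≫ g).left) ↑V₁ V₁.2 (ι.left ⁻¹ᵁ ↑U) hV hleZ hP'V).1 hsm
  have hψsm : (algebraMap Γ(Y.left, ↑V₁) (Localization.AtPrime 𝔮.asIdeal)).FormallySmooth := by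
    rwa [RingHom.formallySmooth_algebraMap]
  have hψ : ∀ a, algebraMap Γ(Y.left, ↑V₁) (Localization.AtPrime 𝔮.asIdeal) a =
      algebraMap Γ(Z.left, ι.left ⁻¹ᵁ ↑U) (Localization.AtPrime 𝔮.asIdeal) (φ a) := fun a =>
    IsScalarTower.algebraMap_apply Γ(Y.left, ↑V₁) Γ(Z.left, ι.left ⁻¹ᵁ ↑U) _ a
  -- evaluation at `P'`, extended to the local ring
  have hunit : ∀ y : 𝔮.asIdeal.primeCompl, IsUnit (P'.evalRingHom (ι.left ⁻¹ᵁ ↑U) hP'V y) := by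
    intro y
    have hy : (y : Γ(Z.left, ι.left ⁻¹ᵁ ↑U)) ∉ 𝔮.asIdeal := y.2
    rw [← mem_basicOpen_iff_notMem_primeIdealOf_aux hV hP'V] at hy
    exact isUnit_iff_ne_zero.2 ((AlgPoints.pt_mem_basicOpen_iff P' hP'V _).1 hy)
  let ε : Localization.AtPrime 𝔮.asIdeal →+* ℂ := IsLocalization.lift (M := 𝔮.asIdeal.primeCompl) hunit
  have hεa : ∀ a : Γ(Z.left, ι.left ⁻¹ᵁ ↑U),
      ε (algebraMap Γ(Z.left, ι.left ⁻¹ᵁ ↑U) (Localization.AtPrime 𝔮.asIdeal) a) =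
        P'.eval (ι.left ⁻¹ᵁ ↑U) hP'V a := fun a => by
    change IsLocalization.lift (M := 𝔮.asIdeal.primeCompl) hunit _ = _
    rw [IsLocalization.lift_eq]
    rfl
  have hcompat : ∀ a : Γ(X.left, ↑U), P'.eval (ι.left ⁻¹ᵁ ↑U) hP'V (res a) = P.eval ↑U hPU a :=
    fun a => by
      have h := eval_appLE ι (V := ↑U) (U := ι.left ⁻¹ᵁ ↑U) le_rfl P' hP'V a
      have key : ∀ (P₁ : ComplexPoints X) (h₂ : P₁.pt ∈ (↑U : X.left.Opens)), P₁ = P →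
          P₁.eval ↑U h₂ a = P.eval ↑U hPU a := by
        rintro P₁ h₂ rfl; rfl
      exact h.trans (key _ _ hP')
  have hcompatY : ∀ a : Γ(Y.left, ↑V₁), P.eval ↑U hPU (φg a) = Q.eval ↑V₁ hQV₁ a := fun a =>
    eval_appLE g hle P hPU a
  have hεR : ∀ a : Γ(Y.left, ↑V₁),
      ε (algebraMap Γ(Y.left, ↑V₁) (Localization.AtPrime 𝔮.asIdeal) a) = Q.eval ↑V₁ hQV₁ a :=
    fun a => by rw [hψ, hεa, ← hcomp, hcompat, hcompatY]
  -- the tangent vector attached to `v ∈ ℂᵐ`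
  have htan : ∀ v : Fin m → ℂ, ∃ ξ : Fin n → ℂ, (∀ j, ℓ j ξ = v j) ∧ ∀ i, μ i ξ = 0 := by
    intro v
    -- the point derivation `a ↦ d(a ∘ e_Y⁻¹)(v)` of `Γ(Y, V₁)` at `Q`
    let D : Γ(Y.left, ↑V₁) →+ ℂ :=
      { toFun := fun a => fderiv ℂ (evalOrZero ↑V₁ a ∘ eY.symm) (eY Q) v
        map_zero' := by
          rw [← map_zero (SchemeOver.scalarRingHom Y (↑V₁ : Y.left.Opens)),
            fderiv_chart_scalarRingHom eY hQ V₁ hQV₁]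
          rfl
        map_add' := fun a b => by
          rw [fderiv_chart_add eY hQ holY V₁ hQV₁]
          rfl }
    have hDa : ∀ a, D a = fderiv ℂ (evalOrZero ↑V₁ a ∘ eY.symm) (eY Q) v := fun a => rfl
    have hDmul : ∀ a b, D (a * b) =
        ε (algebraMap Γ(Y.left, ↑V₁) (Localization.AtPrime 𝔮.asIdeal) a) * D b +
          ε (algebraMap Γ(Y.left, ↑V₁) (Localization.AtPrime 𝔮.asIdeal) b) * D a :=
      fun a b => by
        rw [hεR, hεR, hDa, hDa, hDa, fderiv_chart_mul eY hQ holY V₁ hQV₁]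
        simp
    obtain ⟨D', hD'mul, hD'φ⟩ :=
      Literature.RingTheory.Smooth.exists_pointDerivation_comp_eq hψsm ε D hDmul
    -- the induced point derivation of `Γ(X, U)` at `P`
    let D'' : Γ(X.left, ↑U) →+ ℂ :=
      D'.comp ((algebraMap Γ(Z.left, ι.left ⁻¹ᵁ ↑U) (Localization.AtPrime 𝔮.asIdeal)).toAddMonoidHom.comp
        res.toAddMonoidHom)
    have hD''a : ∀ a, D'' a =
        D' (algebraMap Γ(Z.left, ι.left ⁻¹ᵁ ↑U) (Localization.AtPrime 𝔮.asIdeal) (res a)) :=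
      fun a => rfl
    have hD''mul : ∀ a b, D'' (a * b) = P.eval ↑U hPU a * D'' b + P.eval ↑U hPU b * D'' a :=
      fun a b => by
        rw [hD''a, hD''a, hD''a, map_mul, map_mul, hD'mul, hεa, hεa, hcompat, hcompat]
    have hD''c : ∀ c : ℂ, D'' (SchemeOver.scalarRingHom X ↑U c) = 0 := fun c => by
      rw [hD''a, scalarRingHom_eq_appLE g hle c]
      change D' (algebraMap _ (Localization.AtPrime 𝔮.asIdeal)
        (res (φg (SchemeOver.scalarRingHom Y (↑V₁ : Y.left.Opens) c)))) = 0
      rw [hcomp, ← hψ, hD'φ, hDa, fderiv_chart_scalarRingHom eY hQ V₁ hQV₁]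
      rfl
    obtain ⟨ξ, hξ⟩ :=
      exists_eq_fderiv_chart_of_pointDerivation eX hP holX U hPU t htspan algX D'' hD''mul hD''c
    refine ⟨ξ, fun j => ?_, fun i => ?_⟩
    · rw [hℓ, ← hξ (gs j), hD''a]
      change D' (algebraMap _ (Localization.AtPrime 𝔮.asIdeal) (res (φg (u j)))) = v j
      rw [hcomp, ← hψ, hD'φ, hDa, fderiv_chart_coord eY hQ V₁ u hu j]
      rfl
    · rw [hμ, ← hξ (w i), hD''a, hres0 i, map_zero, map_zero]
  -- ### the `m + r` forms are linearly independent
  have hli : LinearIndependent ℂ (Fin.append ℓ μ) := by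
    rw [Fintype.linearIndependent_iff]
    intro c hc
    -- split the coefficients
    let a : Fin m → ℂ := fun j => c (Fin.castAdd r j)
    let b : Fin r → ℂ := fun i => c (Fin.natAdd m i)
    have hsum : ∑ j, a j • ℓ j + ∑ i, b i • μ i = 0 := by
      rw [← hc, Fin.sum_univ_add]
      simp [a, b]
    -- Step A: `a = 0`
    have ha0 : ∀ j, a j = 0 := by
      intro j₀
      obtain ⟨ξ, hξℓ, hξμ⟩ := htan (Pi.single j₀ 1)
      have h : ∑ j, a j * ℓ j ξ + ∑ i, b i * μ i ξ = 0 := by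
        simpa using congrArg (fun L : (Fin n → ℂ) →L[ℂ] ℂ => L ξ) hsum
      simp only [hξℓ, hξμ, mul_zero, Finset.sum_const_zero, add_zero, Pi.single_apply, mul_ite,
        mul_one, Finset.sum_ite_eq', Finset.mem_univ, if_true] at h
      exact h
    -- Step B: `b = 0`
    have hsuma : ∑ j, a j • ℓ j = 0 := Finset.sum_eq_zero fun j _ => by
      rw [ha0 j]; ext ξ; simp
    have hsumb : ∑ i, b i • μ i = 0 := by rwa [hsuma, zero_add] at hsum
    have hmem : ∑ i, SchemeOver.scalarRingHom X ↑U (b i) * w i ∈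
        RingHom.ker (P.evalRingHom ↑U hPU) := by
      refine Ideal.sum_mem _ fun i _ => Ideal.mul_mem_left _ _ ?_
      -- `wᵢ(P) = (ι^* wᵢ)(P') = 0`
      rw [RingHom.mem_ker, AlgPoints.evalRingHom_apply, ← hcompat, hres0 i, ← AlgPoints.evalRingHom_apply,
        map_zero]
    have hd0 : fderiv ℂ (evalOrZero ↑U (∑ i, SchemeOver.scalarRingHom X ↑U (b i) * w i) ∘ eX.symm)
        (eX P) = 0 := by
      rw [fderiv_chart_sum eX hP holX U hPU]
      simp only [fderiv_chart_smul eX hP holX U hPU]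
      exact hsumb
    have hb0 : b = 0 :=
      hwind b (mem_sq_of_fderiv_chart_eq_zero eX hP holX U hPU t htspan algX hmem hd0)
    intro k
    refine Fin.addCases (fun j => ?_) (fun i => ?_) k
    · exact ha0 j
    · exact congr_fun hb0 i
  -- ### conclusion: the joint map is onto
  have hli' : LinearIndependent ℂ fun k =>
      ((Fin.append ℓ μ k : (Fin n → ℂ) →L[ℂ] ℂ) : (Fin n → ℂ) →ₗ[ℂ] ℂ) :=
    hli.map' (ContinuousLinearMap.coeLM ℂ) (LinearMap.ker_eq_bot.2 ContinuousLinearMap.coe_injective)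
  have hsurj := surjective_pi_of_linearIndependent _ hli'
  intro yz
  obtain ⟨ξ, hξ⟩ := hsurj (Fin.append yz.1 yz.2)
  have hξk : ∀ k, Fin.append ℓ μ k ξ = Fin.append yz.1 yz.2 k := fun k => congr_fun hξ k
  refine ⟨ξ, Prod.ext ?_ ?_⟩
  · funext j
    change fderiv ℂ (eY ∘ AlgPoints.map g ∘ eX.symm) (eX P) ξ j = yz.1 j
    rw [hF, fderiv_pi hdiff, ContinuousLinearMap.pi_apply, hfd j]
    have h := hξk (Fin.castAdd r j)
    simp only [Fin.append_left] at h
    exact h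
  · funext i
    change μ i ξ = yz.2 i
    have h := hξk (Fin.natAdd m i)
    simp only [Fin.append_right] at h
    exact h

end Literature.AlgebraicGeometry.Motives

end
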